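/-
Copyright: lit-balaban cell, Phase-2 proof seat p24 (gen 23).  Released under Apache 2.0 license as described in the
file LICENSE.
-/
import Literature.MathematicalPhysics.QuantumFieldTheory.Balaban1983to89.B4Eq246SummableSolution

/-!
# `Balaban1983to89.B4Eq246SolvesEq244` — [Balaban1983RegularityDecay] p. 584: the inverse transform (2.43) of the formula
# (2.46) SOLVES the basic equation (2.44) for EVERY summable right-hand side `f` — the existence half of «φ₀ = G_jf»

statement-level skeleton of published theorems with citation tags; proofs where landed; nothing here is a claim about
the Yang–Mills mass gap

CITATION HEADER.  T. Bałaban, *Regularity and decay of lattice Green's functions*, Commun. Math. Phys. **89** (1983)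
571–597, doi:10.1007/bf01214744 [Balaban1983RegularityDecay] (cell paper B4; held text
`paper:balaban1983-cmp89-regularity-decay`, journal page = PDF page + 570), p. 584 [PDF 14] (2.43)–(2.46); render
`pub-balaban/b2b-balaban-ref1/pages/1983-cmp89-regularity-decay/1983-cmp89-regularity-decay-p014-x2.png` (unit `lit-balaban-p24`
gen 23; HOME `run/shared/lean/pub/lit-balaban/`; SKELETON row **B4.Eq2.43**; companion of `B4Eq246SummableSolution` (every summable
solution IS (2.46)), `B4Eq244L2Unique` (uniqueness on `ℓ²`) and `B4Green244.green244` (the same verification for the block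
sources `f = Q_j^*δ_y` of (2.47)–(2.48))).

WHAT IS PRINTED (p. 584).  «We apply it [the transform (2.43)] to the basic equation (−Δ^ξ + m_j² + a_jQ_j^*Q_j)φ₀ = f. (2.44)
Defining the propagator G_j, φ₀ = G_jf, we get [(2.45)].  Solving this equation we obtain the following formula: (2.46).»

WHAT THIS MODULE PROVES (kernel-checked; 2 definitions WITH BODY + theorems; 0 `sorry`; 0 `Prop` facts; axioms standard).
For `n = L^j ≥ 1`, `m² > 0`, `a ≥ 0` and a summable `f : ℤ^d → ℂ`:
* `sum_PhZ_fineDiff` — fibre orthogonality of the plane waves: `Σ_l e^{i(p′+l)·(z−w)/n} = n^d·[z ≡ w (mod n)]·e^{ip′·(z−w)/n}`;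
* **`latticeKernel_fibreSum_ftSum`** — THE FIBRE-UNFOLDED INVERSION (2.43)₂ for `f ∈ ℓ¹`:
  `(2π)^{−d}∫_{[−π,π]^d} Σ_l e^{i(p′+l)·z/n} f̃(p′+l) dp′ = f(z)` (the big zone `|p| ≤ π/ξ` of (2.43) cut into the `n^d` fibres
  `p′ + l` of (2.45));
* `blockAvg_PhZ`, `opD_PhZ_mul`, **`opD_fibreComb`** — the operator of (2.44) acts on a fibre combination
  `z ↦ Σ_l e^{i(p′+l)·z/n} c_l` by the left-hand side of (2.45): `D(Σ_l e^{i(p′+l)·z/n}c_l) =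
  Σ_l e^{i(p′+l)·z/n}[Δ^ξ(p′+l)c_l + a u_j(p′+l) Σ_{l′} ū_j(p′+l′) c_{l′}]` (plane waves are eigenfunctions of `−Δ^ξ + m²`,
  `B4Green244.lap_PhZ`; `Q_j^*Q_j` of a plane wave is the block phase times `ū_j`, and the block phase is `Σ_l e^{i(p′+l)·z/n}u_j(p′+l)`,
  `B4Green244.sum_PhZ_V`);
* `G246 n a m² f z := (2π)^{−d}∫_{[−π,π]^d} Σ_l e^{i(p′+l)·z/n}·sol246(p′)_l dp′` — **«φ₀ = G_jf» WITH ITS BODY**: the inverse transform of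
  the right-hand side of (2.46) (`B4Eq246Fibre.sol246` on the fibre data `Δ^ξ(p′+l)`, `u_j(p′+l)`, `f̃(p′+l)`);
* **`opD_G246`** — **(2.46) SOLVES (2.44)**: `(−Δ^ξ + m² + aQ_j^*Q_j)(G246 f) = f` on `ξℤ^d` for every summable `f`
  (`B4Eq246Fibre.eq245_sol246` under the zone integral, then the fibre-unfolded inversion).

DICTIONARY / HONEST SCOPE.  (i) `A = 0`, infinite lattice, scalar fields; `a_j ↦ a ≥ 0`; `m_j² ↦ m² > 0` (so that both
non-vanishing conditions of (2.46) hold at every real `p′`, `B4Eq246SummableSolution`); `f ∈ ℓ¹(ℤ^d)`.  (ii) EXISTENCE only: this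
file does not prove that `G246 f` is summable or square-summable (that is the decay of `G_j`, not in the tree), so the
uniqueness theorems of `B4Eq246SummableSolution`/`B4Eq244L2Unique` are not invoked here; for block sources `f = Q_j^*g` the
tree has the summable solution `B4Eq247TransformGQ.GQ`.  (iii) Fibre representatives `k_μ ∈ {0,…,n−1}`.  Value = kernel
certificate of «Solving this equation we obtain (2.46)» in the existence direction, for general data; NOT summit progress.
-/

namespace Literature.MathematicalPhysics.QuantumFieldTheory.Balaban1983to89.B4Eq246SolvesEq244

open Complex Finset MeasureTheory
open Literature.MathematicalPhysics.QuantumFieldTheory.Balaban1983to89.B4Strip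
open Literature.MathematicalPhysics.QuantumFieldTheory.Balaban1983to89.B4ContourShift
open Literature.MathematicalPhysics.QuantumFieldTheory.Balaban1983to89.B4StripSums
open Literature.MathematicalPhysics.QuantumFieldTheory.Balaban1983to89.B4StripSumsHolder
open Literature.MathematicalPhysics.QuantumFieldTheory.Balaban1983to89.B5Strip145Analytic
  (differentiableAt_DeltaXi_shift)
open Literature.MathematicalPhysics.QuantumFieldTheory.Balaban1983to89.B4Green244
open Literature.MathematicalPhysics.QuantumFieldTheory.Balaban1983to89.B4Eq243TransformSummable
open Literature.MathematicalPhysics.QuantumFieldTheory.Balaban1983to89.B4Eq245Aliasing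
open Literature.MathematicalPhysics.QuantumFieldTheory.Balaban1983to89.B4Eq246Fibre
open Literature.MathematicalPhysics.QuantumFieldTheory.Balaban1983to89.B4Eq246SummableSolution
open scoped Real ComplexConjugate

noncomputable section

variable {d : ℕ}

/-! ### §1 Fibre orthogonality of the plane waves -/

/-- one coordinate: `e^{i(ζ+2πj)s/n} e^{i(ζ+2πj)s′/n} = e^{i(ζ+2πj)(s+s′)/n}`. [folklore] -/
private theorem efZ_mul_efZ (n j : ℕ) (s s' : ℤ) (ζ : ℂ) : efZ n j s ζ * efZ n j s' ζ = efZ n j (s + s') ζ := by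
  unfold efZ
  rw [← Complex.exp_add]
  push_cast
  ring_nf

/-- `e^{i(p′+l)·z/n} e^{−i(p′+l)·w/n} = e^{i(p′+l)·(z−w)/n}`. [folklore] -/
private theorem PhZ_mul_PhZ_neg (n : ℕ) (k : Fin d → Fin n) (z w : Fin d → ℤ) (P : Fin d → ℂ) :
    PhZ n k z P * PhZ n k (-w) P = PhZ n k (z - w) P := by
  unfold PhZ
  rw [← Finset.prod_mul_distrib]
  refine Finset.prod_congr rfl fun ν _ => ?_
  rw [efZ_mul_efZ, Pi.sub_apply, Pi.neg_apply, sub_eq_add_neg]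

/-- one coordinate at a difference of fine points: `e^{i(ζ+2πj)(n(x−y)+(t−s))/n} = e^{iζ(x−y)}·e^{iζ(t−s)/n}·q^j`,
`q = e^{2πi(t−s)/n}`. [folklore] -/
private theorem efZ_fineDiff (n j : ℕ) (hn : n ≠ 0) (x y : ℤ) (t s : ℕ) (ζ : ℂ) :
    efZ n j ((n : ℤ) * x + (t : ℕ) - ((n : ℤ) * y + (s : ℕ))) ζ
      = cexp (I * ζ * ((x : ℂ) - y)) * cexp (I * ζ * ((t : ℂ) - s) / n)
        * cexp (2 * π * I * ((t : ℂ) - s) / n) ^ j := by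
  unfold efZ
  have hn' : (n : ℂ) ≠ 0 := Nat.cast_ne_zero.mpr hn
  rw [← Complex.exp_nat_mul, ← Complex.exp_add, ← Complex.exp_add]
  rw [show I * (ζ + 2 * π * j) * (((n : ℤ) * x + (t : ℕ) - ((n : ℤ) * y + (s : ℕ)) : ℤ) : ℂ) / n
      = I * ζ * ((x : ℂ) - y) + I * ζ * ((t : ℂ) - s) / n + (j : ℂ) * (2 * π * I * ((t : ℂ) - s) / n)
        + ((j * (x - y) : ℤ) : ℂ) * (2 * π * I) by push_cast; field_simp; ring]
  rw [Complex.exp_add, Complex.exp_int_mul_two_pi_mul_I, mul_one]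

/-- **FIBRE ORTHOGONALITY**: `Σ_l e^{i(p′+l)·(z−w)/n} = n^d·[τ = τ′]·e^{ip′·(x⁰−y⁰)}` for `z = nx⁰ + τ`, `w = ny⁰ + τ′` — the
`n^d` plane waves of one fibre are orthogonal on each block. [cite: Balaban1983RegularityDecay, (2.43)–(2.45) p.584, dictionary] -/
theorem sum_PhZ_fineDiff (n : ℕ) [NeZero n] (x y : Fin d → ℤ) (τ τ' : Fin d → Fin n) (P : Fin d → ℂ) :
    ∑ k : Fin d → Fin n, PhZ n k (finePt n x τ - finePt n y τ') P
      = if τ = τ' then (n : ℂ) ^ d * cexp (I * phaseC P (x - y)) else 0 := by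
  have hn : n ≠ 0 := NeZero.ne n
  -- each summand factorises over the coordinates
  have h1 : ∀ k : Fin d → Fin n, PhZ n k (finePt n x τ - finePt n y τ') P
      = ∏ ν, (cexp (I * P ν * ((x ν : ℂ) - y ν)) * cexp (I * P ν * (((τ ν : ℕ) : ℂ) - ((τ' ν : ℕ) : ℂ)) / n)
          * cexp (2 * π * I * (((τ ν : ℕ) : ℂ) - ((τ' ν : ℕ) : ℂ)) / n) ^ (k ν : ℕ)) := by
    intro k
    unfold PhZ
    refine Finset.prod_congr rfl fun ν _ => ?_
    simp only [finePt, Pi.sub_apply]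
    exact efZ_fineDiff n (k ν) hn (x ν) (y ν) (τ ν) (τ' ν) (P ν)
  simp_rw [h1]
  have h := Finset.prod_univ_sum (fun _ : Fin d => (Finset.univ : Finset (Fin n)))
    (fun ν (i : Fin n) => cexp (I * P ν * ((x ν : ℂ) - y ν)) * cexp (I * P ν * (((τ ν : ℕ) : ℂ) - ((τ' ν : ℕ) : ℂ)) / n)
          * cexp (2 * π * I * (((τ ν : ℕ) : ℂ) - ((τ' ν : ℕ) : ℂ)) / n) ^ (i : ℕ))
  rw [Fintype.piFinset_univ] at h
  rw [← h]
  -- the coordinate sums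
  have h2 : ∀ ν : Fin d, ∑ i : Fin n, cexp (I * P ν * ((x ν : ℂ) - y ν))
        * cexp (I * P ν * (((τ ν : ℕ) : ℂ) - ((τ' ν : ℕ) : ℂ)) / n)
        * cexp (2 * π * I * (((τ ν : ℕ) : ℂ) - ((τ' ν : ℕ) : ℂ)) / n) ^ (i : ℕ)
      = if (τ' ν : ℕ) = (τ ν : ℕ) then (n : ℂ) * cexp (I * P ν * ((x ν : ℂ) - y ν)) else 0 := by
    intro ν
    rw [← Finset.mul_sum,
      Fin.sum_univ_eq_sum_range (fun i => cexp (2 * π * I * (((τ ν : ℕ) : ℂ) - ((τ' ν : ℕ) : ℂ)) / n) ^ i) n,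
      sum_rootOfUnity_pow n (τ ν) (τ' ν) hn (τ ν).isLt (τ' ν).isLt]
    by_cases hh : (τ' ν : ℕ) = (τ ν : ℕ)
    · rw [if_pos hh, if_pos hh]
      have : ((τ ν : ℕ) : ℂ) - ((τ' ν : ℕ) : ℂ) = 0 := by rw [hh, sub_self]
      rw [this, mul_zero, zero_div, Complex.exp_zero, mul_one, mul_comm]
    · rw [if_neg hh, if_neg hh, mul_zero]
  simp_rw [h2]
  split_ifs with hτ
  · subst hτ
    simp only [if_true]
    rw [Finset.prod_mul_distrib, Finset.prod_const, Finset.card_univ, Fintype.card_fin]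
    congr 1
    rw [← Complex.exp_sum]
    unfold phaseC
    congr 1
    rw [Finset.mul_sum]
    refine Finset.sum_congr rfl fun ν _ => ?_
    simp only [Pi.sub_apply]; push_cast; ring
  · obtain ⟨ν, hν⟩ := Function.ne_iff.mp hτ
    have hν' : (τ' ν : ℕ) ≠ (τ ν : ℕ) := fun h => hν (Fin.ext h).symm
    exact Finset.prod_eq_zero (Finset.mem_univ ν) (if_neg hν')

/-! ### §2 The fibre-unfolded inversion (2.43)₂ for summable `f` -/

/-- the fibre sum of the transform with its plane waves, read at the fine point `z`:
`Σ_l e^{i(p′+l)·z/n} f̃(p′+l)` (a function of the REDUCED momentum `p′`). [cite: Balaban1983RegularityDecay, (2.43), (2.45) p.584] -/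
def fibreSum (n : ℕ) (f : (Fin d → ℤ) → ℂ) (z : Fin d → ℤ) (P : Fin d → ℂ) : ℂ :=
  ∑ k : Fin d → Fin n, PhZ n k z P * ftSum n f (shift n k P)

/-- the fibre sum as a series over the block row of `z` (real reduced momentum): `Σ_l e^{i(p′+l)·z/n} f̃(p′+l) =
Σ_y e^{ip′·(x⁰−y)} f(ny + τ)`, `z = nx⁰ + τ`. [cite: Balaban1983RegularityDecay, (2.43), (2.45) p.584] -/
theorem fibreSum_eq_tsum (n : ℕ) [NeZero n] {f : (Fin d → ℤ) → ℂ} (hf : Summable fun z => ‖f z‖) (x : Fin d → ℤ)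
    (τ : Fin d → Fin n) (p : Fin d → ℝ) :
    fibreSum n f (finePt n x τ) (ofRealVec p)
      = ∑' y : Fin d → ℤ, cexp (I * phaseC (ofRealVec p) (x - y)) * f (finePt n y τ) := by
  have hn : n ≠ 0 := NeZero.ne n
  have hnC : ((n : ℂ) ^ d) ≠ 0 := pow_ne_zero _ (Nat.cast_ne_zero.mpr hn)
  have hP : Summable (ftTerm n f (ofRealVec p)) := summable_ftTerm_ofRealVec n hf p
  set P := ofRealVec p with hPdef
  unfold fibreSum ftSum
  -- bring the finite fibre sum inside the series
  have hterm : ∀ (k : Fin d → Fin n) (w : Fin d → ℤ),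
      PhZ n k (finePt n x τ) P * ftTerm n f (shift n k P) w = PhZ n k (finePt n x τ - w) P * f w := by
    intro k w
    rw [ftTerm_shift, ← mul_assoc, PhZ_mul_PhZ_neg]
  have hsk : ∀ k : Fin d → Fin n, Summable fun w => PhZ n k (finePt n x τ - w) P * f w := by
    intro k
    have h0 := (summable_ftTerm_shift n hP k).mul_left (PhZ n k (finePt n x τ) P)
    exact h0.congr fun w => hterm k w
  have h1 : ∑ k : Fin d → Fin n, PhZ n k (finePt n x τ) P * (((n : ℂ) ^ d)⁻¹ * ∑' w, ftTerm n f (shift n k P) w)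
      = ((n : ℂ) ^ d)⁻¹ * ∑' w, ∑ k : Fin d → Fin n, PhZ n k (finePt n x τ - w) P * f w := by
    rw [Summable.tsum_finsetSum (fun k _ => hsk k), Finset.mul_sum]
    refine Finset.sum_congr rfl fun k _ => ?_
    have h5 : ∑' w, PhZ n k (finePt n x τ - w) P * f w = ∑' w, PhZ n k (finePt n x τ) P * ftTerm n f (shift n k P) w :=
      tsum_congr fun w => (hterm k w).symm
    rw [h5, tsum_mul_left]
    ring
  rw [h1]
  -- re-index the series by blocks; only the block row with offset `τ` survives
  have h2 : ∑' w, ∑ k : Fin d → Fin n, PhZ n k (finePt n x τ - w) P * f w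
      = ∑' yσ : (Fin d → ℤ) × (Fin d → Fin n),
          ∑ k : Fin d → Fin n, PhZ n k (finePt n x τ - finePt n yσ.1 yσ.2) P * f (finePt n yσ.1 yσ.2) := by
    rw [← (blockEquiv n).tsum_eq]; rfl
  rw [h2]
  set A : (Fin d → ℤ) × (Fin d → Fin n) → ℂ :=
    fun yσ => (n : ℂ) ^ d * (cexp (I * phaseC P (x - yσ.1)) * f (finePt n yσ.1 yσ.2)) with hA
  have h3 : ∀ yσ : (Fin d → ℤ) × (Fin d → Fin n),
      ∑ k : Fin d → Fin n, PhZ n k (finePt n x τ - finePt n yσ.1 yσ.2) P * f (finePt n yσ.1 yσ.2)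
        = if τ = yσ.2 then A yσ else 0 := by
    intro yσ
    rw [← Finset.sum_mul, sum_PhZ_fineDiff, hA]
    by_cases h : τ = yσ.2
    · rw [if_pos h, if_pos h]; ring
    · rw [if_neg h, if_neg h, zero_mul]
  rw [tsum_congr h3]
  -- the surviving terms are the image of `y ↦ (y, τ)`
  have hinj : Function.Injective fun y : Fin d → ℤ => (y, τ) := fun y y' h => (Prod.mk.inj h).1
  have hsupp : Function.support (fun yσ : (Fin d → ℤ) × (Fin d → Fin n) => if τ = yσ.2 then A yσ else 0)
      ⊆ Set.range fun y : Fin d → ℤ => (y, τ) := by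
    intro yσ hyσ
    rw [Function.mem_support] at hyσ
    by_cases h : τ = yσ.2
    · exact ⟨yσ.1, by rw [h]⟩
    · exact absurd (if_neg h) hyσ
  rw [← hinj.tsum_eq hsupp]
  simp only [if_true, hA]
  rw [tsum_mul_left, ← mul_assoc, inv_mul_cancel₀ hnC, one_mul]

/-- **THE FIBRE-UNFOLDED INVERSION (2.43)₂** for summable `f`: `(2π)^{−d}∫_{[−π,π]^d} Σ_l e^{i(p′+l)·z/n} f̃(p′+l) dp′ = f(z)`
(the zone `|p| ≤ π/ξ` of (2.43) cut into the fibres `p′ + l` of (2.45)). [cite: Balaban1983RegularityDecay, (2.43) p.584] -/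
theorem latticeKernel_fibreSum_ftSum (n : ℕ) [NeZero n] {f : (Fin d → ℤ) → ℂ} (hf : Summable fun z => ‖f z‖)
    (z : Fin d → ℤ) : latticeKernel (fibreSum n f z) 0 = f z := by
  conv_lhs => rw [← finePt_coarse_offset n z]
  set x := coarse n z
  set τ := offset n z
  -- the block-row series, re-centred at `x`
  set φ : (Fin d → ℤ) → ℂ := fun y => f (finePt n (y + x) τ) with hφ
  have hφs : Summable fun y => ‖φ y‖ := by
    have hinj : Function.Injective fun y : Fin d → ℤ => finePt n (y + x) τ := by
      intro y y' h
      have := congrArg (coarse n) h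
      simpa [coarse_finePt] using this
    exact hf.comp_injective hinj
  set G2 : (Fin d → ℂ) → ℂ := fun P => ∑' y, cexp (-(I * phaseC P y)) * φ y with hG2
  have h1 : ∀ p ∈ BZ d, fibreSum n f (finePt n x τ) (ofRealVec p) = G2 (ofRealVec p) := by
    intro p _
    rw [fibreSum_eq_tsum n hf x τ p, hG2]
    simp only
    rw [← (Equiv.addRight x).tsum_eq]
    refine tsum_congr fun y => ?_
    simp only [Equiv.coe_addRight, hφ]
    congr 1
    have hxy : x - (y + x) = -y := by abel
    rw [hxy, B4Eq243Transform.phaseC_neg, mul_neg]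
  rw [latticeKernel_congr h1, latticeKernel_tsum_phase hφs]
  simp only [hφ, zero_add]
  exact congrArg f (finePt_coarse_offset n z)

/-! ### §3 The operator of (2.44) on a fibre combination: the left-hand side of (2.45) -/

/-- one coordinate: at a real momentum the reflected wave is the conjugate wave. [folklore] -/
private theorem conj_efZ_neg (n j : ℕ) (s : ℤ) (x : ℝ) : conj (efZ n j (-s) (x : ℂ)) = efZ n j s (x : ℂ) := by
  unfold efZ
  have h1 : I * ((x : ℂ) + 2 * π * j) * ((-s : ℤ) : ℂ) / n = ((-((x + 2 * π * j) * s / n) : ℝ) : ℂ) * I := by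
    push_cast; ring
  have h2 : I * ((x : ℂ) + 2 * π * j) * ((s : ℤ) : ℂ) / n = (((x + 2 * π * j) * s / n : ℝ) : ℂ) * I := by
    push_cast; ring
  rw [h1, h2, ← Complex.exp_conj, map_mul, Complex.conj_ofReal, Complex.conj_I]
  congr 1
  push_cast
  ring

/-- a plane wave at a real momentum is the conjugate of its reflected twin. [folklore] -/
private theorem PhZ_ofRealVec_eq_conj (n : ℕ) (k : Fin d → Fin n) (z : Fin d → ℤ) (p : Fin d → ℝ) :
    PhZ n k z (ofRealVec p) = conj (PhZ n k (-z) (ofRealVec p)) := by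
  unfold PhZ
  rw [map_prod]
  refine Finset.prod_congr rfl fun ν _ => ?_
  simp only [Pi.neg_apply, ofRealVec]
  exact (conj_efZ_neg n (k ν) (z ν) (p ν)).symm

/-- the conjugate of the block phase. [folklore] -/
private theorem conj_cexp_neg_phaseC_real (p : Fin d → ℝ) (x : Fin d → ℤ) :
    conj (cexp (-(I * phaseC (ofRealVec p) x))) = cexp (I * phaseC (ofRealVec p) x) := by
  have h1 : I * phaseC (ofRealVec p) x = ((∑ μ, p μ * (x μ : ℝ) : ℝ) : ℂ) * I := by
    unfold phaseC ofRealVec; push_cast; ring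
  rw [h1, ← Complex.exp_conj, map_neg, map_mul, Complex.conj_ofReal, Complex.conj_I]
  congr 1
  ring

/-- **`Q_j^*Q_j` OF A PLANE WAVE** (real reduced momentum): the block average of `z ↦ e^{i(p′+l)·z/n}` over `B(x⁰)` is
`e^{ip′·x⁰}·ū_j(p′+l)`. [cite: Balaban1983RegularityDecay, (2.45) p.584] -/
theorem blockAvg_PhZ (n : ℕ) [NeZero n] (k : Fin d → Fin n) (p : Fin d → ℝ) (z : Fin d → ℤ) :
    blockAvg n (fun z' => PhZ n k z' (ofRealVec p)) z
      = cexp (I * phaseC (ofRealVec p) (coarse n z)) * Vb n k (ofRealVec p) := by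
  unfold blockAvg
  have h1 : ∑ j : Fin d → Fin n, PhZ n k (finePt n (coarse n z) j) (ofRealVec p)
      = conj (∑ j : Fin d → Fin n, PhZ n k (-(finePt n (coarse n z) j)) (ofRealVec p)) := by
    rw [map_sum]
    exact Finset.sum_congr rfl fun j _ => PhZ_ofRealVec_eq_conj n k _ p
  have hn : conj (((n : ℂ) ^ d)⁻¹) = ((n : ℂ) ^ d)⁻¹ := by simp
  rw [h1, ← hn, ← map_mul, sum_PhZ_neg_finePt, map_mul, conj_cexp_neg_phaseC_real, Vb_ofRealVec]

/-- `−Δ^ξ` and `Q_j^*Q_j` are linear: a constant factor passes through. [folklore] -/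
private theorem negLap_mul_const (n : ℕ) (g : (Fin d → ℤ) → ℂ) (c : ℂ) (z : Fin d → ℤ) :
    negLap n (fun z' => g z' * c) z = c * negLap n g z := by
  unfold negLap
  rw [Finset.mul_sum, Finset.mul_sum, Finset.mul_sum]
  refine Finset.sum_congr rfl fun μ _ => by ring

/-- a constant factor passes through the block average. [folklore] -/
private theorem blockAvg_mul_const (n : ℕ) (g : (Fin d → ℤ) → ℂ) (c : ℂ) (z : Fin d → ℤ) :
    blockAvg n (fun z' => g z' * c) z = c * blockAvg n g z := by
  unfold blockAvg
  rw [← Finset.sum_mul]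
  ring

/-- `D` applied to one plane wave with a coefficient: `D(e^{i(p′+l)·z/n}c) = c·(e^{i(p′+l)·z/n}Δ^ξ(p′+l) + a e^{ip′·x⁰}ū_j(p′+l))`.
[cite: Balaban1983RegularityDecay, (2.45) p.584] -/
theorem opD_PhZ_mul (n : ℕ) [NeZero n] (a m2 : ℝ) (k : Fin d → Fin n) (p : Fin d → ℝ) (c : ℂ) (z : Fin d → ℤ) :
    opD n a m2 (fun z' => PhZ n k z' (ofRealVec p) * c) z
      = c * (PhZ n k z (ofRealVec p) * DeltaXi n m2 (shift n k (ofRealVec p))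
          + a * (cexp (I * phaseC (ofRealVec p) (coarse n z)) * Vb n k (ofRealVec p))) := by
  have hL := lap_PhZ n m2 k z (ofRealVec p)
  unfold opD
  rw [negLap_mul_const, blockAvg_mul_const, blockAvg_PhZ]
  unfold negLap at hL ⊢
  linear_combination c * hL

/-- `D` is additive over finite families. [folklore] -/
private theorem opD_finset_sum {ι : Type*} (s : Finset ι) (n : ℕ) (a m2 : ℝ) (g : ι → (Fin d → ℤ) → ℂ) (z : Fin d → ℤ) :
    opD n a m2 (fun z' => ∑ i ∈ s, g i z') z = ∑ i ∈ s, opD n a m2 (g i) z := by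
  simp only [opD_eq_stencil, Finset.mul_sum]
  rw [Finset.sum_comm]

/-- **THE LEFT-HAND SIDE OF (2.45)**: on a fibre combination `z ↦ Σ_l e^{i(p′+l)·z/n} c_l` (real `p′`) the operator of (2.44) acts
by `D(Σ_l e^{i(p′+l)·z/n}c_l) = Σ_l e^{i(p′+l)·z/n}[Δ^ξ(p′+l)c_l + a u_j(p′+l) Σ_{l′} ū_j(p′+l′)c_{l′}]` — plane waves are
eigenfunctions of `−Δ^ξ + m²` and `Q_j^*Q_j` couples the fibre through `ū_j`, the block phase being `Σ_l e^{i(p′+l)·z/n}u_j(p′+l)`.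
[cite: Balaban1983RegularityDecay, (2.45) p.584] -/
theorem opD_fibreComb (n : ℕ) [NeZero n] (a m2 : ℝ) (c : (Fin d → Fin n) → ℂ) (p : Fin d → ℝ) (z : Fin d → ℤ) :
    opD n a m2 (fun z' => ∑ k : Fin d → Fin n, PhZ n k z' (ofRealVec p) * c k) z
      = ∑ k : Fin d → Fin n, PhZ n k z (ofRealVec p)
          * (DeltaXi n m2 (shift n k (ofRealVec p)) * c k
              + a * V n k (ofRealVec p) * ∑ k', conj (V n k' (ofRealVec p)) * c k') := by
  rw [opD_finset_sum]
  simp_rw [opD_PhZ_mul]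
  rw [← sum_PhZ_V n z (ofRealVec p)]
  simp_rw [Vb_ofRealVec]
  -- pure algebra: `Σ_k c_k (Φ_k Δ_k + a (Σ_{k'} Φ_{k'} V_{k'}) V̄_k) = Σ_k Φ_k (Δ_k c_k + a V_k Σ_{k'} V̄_{k'} c_{k'})`
  set S : ℂ := ∑ k', conj (V n k' (ofRealVec p)) * c k' with hS
  have h1 : ∀ k : Fin d → Fin n, c k * (PhZ n k z (ofRealVec p) * DeltaXi n m2 (shift n k (ofRealVec p))
        + a * ((∑ k', PhZ n k' z (ofRealVec p) * V n k' (ofRealVec p)) * conj (V n k (ofRealVec p))))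
      = PhZ n k z (ofRealVec p) * (DeltaXi n m2 (shift n k (ofRealVec p)) * c k)
        + a * (conj (V n k (ofRealVec p)) * c k) * ∑ k', PhZ n k' z (ofRealVec p) * V n k' (ofRealVec p) := by
    intro k; ring
  simp_rw [h1]
  rw [Finset.sum_add_distrib, ← Finset.sum_mul, ← Finset.mul_sum, ← hS]
  have h2 : ∀ k : Fin d → Fin n, PhZ n k z (ofRealVec p)
        * (DeltaXi n m2 (shift n k (ofRealVec p)) * c k + a * V n k (ofRealVec p) * S)
      = PhZ n k z (ofRealVec p) * (DeltaXi n m2 (shift n k (ofRealVec p)) * c k)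
        + a * S * (PhZ n k z (ofRealVec p) * V n k (ofRealVec p)) := by
    intro k; ring
  simp_rw [h2]
  rw [Finset.sum_add_distrib, ← Finset.mul_sum]

/-! ### §4 «φ₀ = G_jf»: the inverse transform of (2.46) solves (2.44) -/

/-- the right-hand side of (2.46) on the fibre of the reduced momentum `p′`, for the data `f`:
`sol246(p′)_l` with `Δ_l = Δ^ξ(p′+l)`, `u_l = u_j(p′+l)`, `F_l = f̃(p′+l)`. [cite: Balaban1983RegularityDecay, (2.46) p.584] -/
def sol246Fibre (n : ℕ) (a m2 : ℝ) (f : (Fin d → ℤ) → ℂ) (P : Fin d → ℂ) (k : Fin d → Fin n) : ℂ :=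
  sol246 (a : ℂ) (fun k' : Fin d → Fin n => DeltaXi n m2 (shift n k' P)) (fun k' => V n k' P)
    (fun k' => ftSum n f (shift n k' P)) k

/-- **«φ₀ = G_jf» WITH ITS BODY**: the inverse transform (2.43) of the right-hand side of (2.46),
`(G_jf)(ξz) = (2π)^{−d}∫_{[−π,π]^d} Σ_l e^{i(p′+l)·z/n} sol246(p′)_l dp′`. [cite: Balaban1983RegularityDecay, (2.43), (2.46) p.584] -/
def G246 (n : ℕ) (a m2 : ℝ) (f : (Fin d → ℤ) → ℂ) (z : Fin d → ℤ) : ℂ :=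
  latticeKernel (fun P => ∑ k : Fin d → Fin n, PhZ n k z P * sol246Fibre n a m2 f P k) 0

/-- continuity of the fibre data in the real reduced momentum. [folklore] -/
private theorem continuous_fibreData (n : ℕ) [NeZero n] (m2 : ℝ) {f : (Fin d → ℤ) → ℂ} (hf : Summable fun z => ‖f z‖)
    (k : Fin d → Fin n) :
    Continuous (fun p : Fin d → ℝ => DeltaXi n m2 (shift n k (ofRealVec p)))
    ∧ Continuous (fun p : Fin d → ℝ => V n k (ofRealVec p))
    ∧ Continuous (fun p : Fin d → ℝ => ftSum n f (shift n k (ofRealVec p))) := by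
  refine ⟨?_, ?_, ?_⟩
  · have hD : Continuous fun P : Fin d → ℂ => DeltaXi n m2 (shift n k P) :=
      continuous_iff_continuousAt.mpr fun q => (differentiableAt_DeltaXi_shift n m2 k q).continuousAt
    exact hD.comp continuous_ofRealVec
  · have hV : Continuous (V n k : (Fin d → ℂ) → ℂ) := by
      have : V n k = F n (fun _ => (0 : Fin n)) k := by funext P; rw [F_zero]
      rw [this]
      exact continuous_iff_continuousAt.mpr fun q => (differentiableAt_F n _ k q).continuousAt
    exact hV.comp continuous_ofRealVec
  · have hs : Continuous fun p : Fin d → ℝ => shiftr n k p :=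
      continuous_pi fun μ => ((continuous_apply μ).add continuous_const)
    have := (continuous_ftSum_ofRealVec n hf).comp hs
    refine this.congr fun p => ?_
    simp only [Function.comp, shift_ofReal]

/-- the right-hand side of (2.46) is continuous in the real reduced momentum (`m² > 0`, `a ≥ 0`: no vanishing denominators).
[cite: Balaban1983RegularityDecay, (2.46) p.584] -/
theorem continuous_sol246Fibre (n : ℕ) [NeZero n] {a m2 : ℝ} (ha : 0 ≤ a) (hm : 0 < m2) {f : (Fin d → ℤ) → ℂ}
    (hf : Summable fun z => ‖f z‖) (k : Fin d → Fin n) :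
    Continuous fun p : Fin d → ℝ => sol246Fibre n a m2 f (ofRealVec p) k := by
  have hΔ := fun k' => (continuous_fibreData n m2 hf k').1
  have hV := fun k' => (continuous_fibreData n m2 hf k').2.1
  have hF := fun k' => (continuous_fibreData n m2 hf k').2.2
  have hΔ0 : ∀ k' (p : Fin d → ℝ), DeltaXi n m2 (shift n k' (ofRealVec p)) ≠ 0 :=
    fun k' p => deltaXi_shift_ne_zero_of_pos n hm p k'
  have hB : Continuous fun p : Fin d → ℝ => bracket246 (a : ℂ)
      (fun k' : Fin d → Fin n => DeltaXi n m2 (shift n k' (ofRealVec p))) (fun k' => V n k' (ofRealVec p)) := by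
    unfold bracket246
    refine (continuous_const.mul (continuous_finsetSum _ fun k' _ => ?_)).add continuous_const
    exact ((Complex.continuous_ofReal.comp (continuous_norm.comp (hV k'))).pow 2).div (hΔ k') (hΔ0 k')
  have hB0 : ∀ p : Fin d → ℝ, bracket246 (a : ℂ)
      (fun k' : Fin d → Fin n => DeltaXi n m2 (shift n k' (ofRealVec p))) (fun k' => V n k' (ofRealVec p)) ≠ 0 :=
    fun p => bracket246_ne_zero_of_pos n ha hm p
  unfold sol246Fibre sol246
  refine ((hF k).div (hΔ k) (hΔ0 k)).sub ?_
  refine ((((hV k).div (hΔ k) (hΔ0 k)).mul (continuous_const.div hB hB0)).mul ?_)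
  refine continuous_finsetSum _ fun k' _ => ?_
  exact ((Complex.continuous_conj.comp (hV k')).div (hΔ k') (hΔ0 k')).mul (hF k')

/-- the multiplier of `G246` is integrable on the zone (continuous on a compact box). [folklore] -/
private theorem integrableOn_multiplier (n : ℕ) [NeZero n] {a m2 : ℝ} (ha : 0 ≤ a) (hm : 0 < m2)
    {f : (Fin d → ℤ) → ℂ} (hf : Summable fun z => ‖f z‖) (z : Fin d → ℤ) :
    IntegrableOn (integrand (fun P => ∑ k : Fin d → Fin n, PhZ n k z P * sol246Fibre n a m2 f P k) 0) (BZ d) := by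
  have hc : Continuous (integrand (fun P => ∑ k : Fin d → Fin n, PhZ n k z P * sol246Fibre n a m2 f P k) 0) := by
    unfold integrand
    refine Continuous.mul (continuous_finsetSum _ fun k _ => ?_) ?_
    · have hPh : Continuous fun P : Fin d → ℂ => PhZ n k z P :=
        continuous_iff_continuousAt.mpr fun q => (differentiableAt_PhZ n k z q).continuousAt
      exact (hPh.comp continuous_ofRealVec).mul (continuous_sol246Fibre n ha hm hf k)
    · unfold phase
      fun_prop
  unfold BZ
  exact hc.integrableOn_Icc

/-- **(2.46) SOLVES (2.44)**: for every summable `f` (`m² > 0`, `a ≥ 0`) the inverse transform of the right-hand side of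
(2.46) satisfies `(−Δ^ξ + m² + aQ_j^*Q_j)(G_jf) = f` on the fine lattice `ξℤ^d` — the existence half of «Defining the
propagator G_j, φ₀ = G_jf … Solving this equation we obtain (2.46)». [cite: Balaban1983RegularityDecay, (2.44)–(2.46) p.584] -/
theorem opD_G246 (n : ℕ) [NeZero n] {a m2 : ℝ} (ha : 0 ≤ a) (hm : 0 < m2) {f : (Fin d → ℤ) → ℂ}
    (hf : Summable fun z => ‖f z‖) (z : Fin d → ℤ) : opD n a m2 (G246 n a m2 f) z = f z := by
  unfold G246
  rw [opD_latticeKernel n a m2 (fun z' P => ∑ k : Fin d → Fin n, PhZ n k z' P * sol246Fibre n a m2 f P k) 0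
    (fun z' => integrableOn_multiplier n ha hm hf z') z]
  -- under the zone integral: the left-hand side of (2.45) on the fibre combination, closed by (2.46)
  have h1 : ∀ p ∈ BZ d,
      (fun P => opD n a m2 (fun z' => ∑ k : Fin d → Fin n, PhZ n k z' P * sol246Fibre n a m2 f P k) z) (ofRealVec p)
        = fibreSum n f z (ofRealVec p) := by
    intro p _
    simp only
    rw [opD_fibreComb]
    unfold fibreSum
    refine Finset.sum_congr rfl fun k _ => ?_
    congr 1
    exact eq245_sol246 (a : ℂ) (fun k' => V n k' (ofRealVec p)) (fun k' => ftSum n f (shift n k' (ofRealVec p)))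
      (fun k' => deltaXi_shift_ne_zero_of_pos n hm p k') (bracket246_ne_zero_of_pos n ha hm p) k
  rw [latticeKernel_congr h1]
  exact latticeKernel_fibreSum_ftSum n hf z

end

end Literature.MathematicalPhysics.QuantumFieldTheory.Balaban1983to89.B4Eq246SolvesEq244
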